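import Mathlib
import Literature.Probability.LatticeModels.ThermodynamicLimit
import HarnessLib

/-!
# Route `RecentredCoverTransfer` (LINE g9-B′, planner ym-idea-1 g9), crux `NearDiagonalVanishing` (stmt-QuantumFields-23257) —
# I: the near-diagonal COUNT (route-independent combinatorics)

The UV half `NearDiagonalVanishing` asks that the near-diagonal part of the centred `n`-point moment sums
`Σ_{x ∈ box(L_k)ⁿ, some pair at physical sup-distance < δ} |W_k(x)|·‖F(a_k x)‖` be `≤ ε` eventually, on the torus and on the
checkerboard cover.  On the torus the tree's E0′ toolkit (`OSLegsFromFemtoAndGap.pointwise_bound`) already gives the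
dimension-4 normalisation `|W_k(x)|·‖F(a_k x)‖ ≤ B·a_k^{4n}` at EVERY multi-site; what is left is a COUNT, done here in
abstract form (arbitrary weights `W`, `Φ ≥ 0` with `|W|·Φ ≤ B a^{4n}` and `Φ(x) = 0` as soon as some `a‖xᵢ‖ > K`):

* §1 `card_filter_sub_mem_le`, `card_filter_near_le` — `#{x ∈ Sⁿ : xⱼ − xᵢ ∈ V} ≤ |S|^{n−1}|V|` (insert/remove the
  `j`-th coordinate) and its union over ordered pairs, `≤ n²|S|^{n−1}|V|`;
* §2 `abs_le_floor_of_abs_le`, `pow_four_mul_card_box_floor_le` — membership in `box ⌊t/a⌋` from `|z_l| ≤ t/a`, and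
  `a⁴·#box(⌊t/a⌋) ≤ (2t + a)⁴`;
* §3 ★ `near_sum_le` — the near-diagonal sum is `≤ B·n²·(2K+1)^{4(n−1)}·(3δ)⁴` for `0 < a ≤ min 1 δ`;
  `ite_near_mono` — the near-diagonal indicator sums are monotone in `δ`.

Width seat ym-line-sfw-p2-w2 g23 (cell ym-idea-1; free hands), `--supports stmt-QuantumFields-23257`.  Pure combinatorics; no
crux, rung or summit is proved here and the Yang–Mills mass gap is NOT proved.
-/

set_option autoImplicit false

open scoped BigOperators
open Finset
open Literature.Probability.LatticeModels (Site box mem_box card_box)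

namespace Summit.QuantumFields.YangMills.Theorems.RecentredCoverTransfer.NearDiagonal

/-! ## §1 Counting tuples with one constrained difference -/

/-- **One constrained difference.**  For finite `S, V ⊆ ℤ⁴` and indices `i ≠ j` of `Fin (m+1)`:
`#{x ∈ S^{m+1} : x j − x i ∈ V} ≤ |S|^m · |V|` — the tuple is recovered from its `j`-deleted part and the difference
`x j − x i` (`Fin.insertNth` / `Fin.removeNth`). [folklore] -/
theorem card_filter_sub_mem_le (S V : Finset (Site 4)) {m : ℕ} {i j : Fin (m + 1)} (hij : i ≠ j) :
    #{x ∈ Fintype.piFinset (fun _ : Fin (m + 1) => S) | x j - x i ∈ V} ≤ #S ^ m * #V := by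
  classical
  obtain ⟨i', hi'⟩ := Fin.exists_succAbove_eq hij
  set Φ : (Fin m → Site 4) × Site 4 → (Fin (m + 1) → Site 4) :=
    fun yv => Fin.insertNth (α := fun _ => Site 4) j (yv.1 i' + yv.2) yv.1 with hΦ
  have hsub : {x ∈ Fintype.piFinset (fun _ : Fin (m + 1) => S) | x j - x i ∈ V} ⊆
      ((Fintype.piFinset (fun _ : Fin m => S)) ×ˢ V).image Φ := by
    intro x hx
    rw [Finset.mem_filter, Fintype.mem_piFinset] at hx
    obtain ⟨hxS, hxV⟩ := hx
    rw [Finset.mem_image]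
    refine ⟨(Fin.removeNth (α := fun _ => Site 4) j x, x j - x i), ?_, ?_⟩
    · rw [Finset.mem_product, Fintype.mem_piFinset]
      exact ⟨fun k => hxS _, hxV⟩
    · have h1 : Fin.removeNth (α := fun _ => Site 4) j x i' + (x j - x i) = x j := by
        rw [Fin.removeNth_apply, hi']; abel
      show Fin.insertNth (α := fun _ => Site 4) j (Fin.removeNth (α := fun _ => Site 4) j x i' + (x j - x i))
          (Fin.removeNth (α := fun _ => Site 4) j x) = x
      rw [h1]
      exact Fin.insertNth_self_removeNth j x
  calc #{x ∈ Fintype.piFinset (fun _ : Fin (m + 1) => S) | x j - x i ∈ V}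
      ≤ #(((Fintype.piFinset (fun _ : Fin m => S)) ×ˢ V).image Φ) := Finset.card_le_card hsub
    _ ≤ #((Fintype.piFinset (fun _ : Fin m => S)) ×ˢ V) := Finset.card_image_le
    _ = #S ^ m * #V := by rw [Finset.card_product, Fintype.card_piFinset_const]

/-- **Near tuples.**  `#{x ∈ S^{m+1} : ∃ i ≠ j, x j − x i ∈ V} ≤ (m+1)² · |S|^m · |V|` (union over ordered pairs). [folklore] -/
theorem card_filter_near_le (S V : Finset (Site 4)) (m : ℕ) :
    #{x ∈ Fintype.piFinset (fun _ : Fin (m + 1) => S) | ∃ i j : Fin (m + 1), i ≠ j ∧ x j - x i ∈ V} ≤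
      (m + 1) ^ 2 * (#S ^ m * #V) := by
  classical
  set T := Fintype.piFinset (fun _ : Fin (m + 1) => S) with hT
  have hsub : {x ∈ T | ∃ i j : Fin (m + 1), i ≠ j ∧ x j - x i ∈ V} ⊆
      (Finset.univ : Finset (Fin (m + 1) × Fin (m + 1))).biUnion
        (fun p => {x ∈ T | p.1 ≠ p.2 ∧ x p.2 - x p.1 ∈ V}) := by
    intro x hx
    rw [Finset.mem_filter] at hx
    obtain ⟨hxT, i, j, hij, hV⟩ := hx
    rw [Finset.mem_biUnion]
    exact ⟨(i, j), Finset.mem_univ _, by rw [Finset.mem_filter]; exact ⟨hxT, hij, hV⟩⟩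
  have hpair : ∀ p : Fin (m + 1) × Fin (m + 1), #{x ∈ T | p.1 ≠ p.2 ∧ x p.2 - x p.1 ∈ V} ≤ #S ^ m * #V := by
    intro p
    by_cases hp : p.1 = p.2
    · have h0 : {x ∈ T | p.1 ≠ p.2 ∧ x p.2 - x p.1 ∈ V} = ∅ := by
        ext x; simp [hp]
      rw [h0, Finset.card_empty]; exact Nat.zero_le _
    · calc #{x ∈ T | p.1 ≠ p.2 ∧ x p.2 - x p.1 ∈ V} ≤ #{x ∈ T | x p.2 - x p.1 ∈ V} :=
            Finset.card_le_card fun x hx => by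
              rw [Finset.mem_filter] at hx ⊢; exact ⟨hx.1, hx.2.2⟩
        _ ≤ #S ^ m * #V := card_filter_sub_mem_le S V hp
  calc #{x ∈ T | ∃ i j : Fin (m + 1), i ≠ j ∧ x j - x i ∈ V}
      ≤ #((Finset.univ : Finset (Fin (m + 1) × Fin (m + 1))).biUnion
          (fun p => {x ∈ T | p.1 ≠ p.2 ∧ x p.2 - x p.1 ∈ V})) := Finset.card_le_card hsub
    _ ≤ ∑ p : Fin (m + 1) × Fin (m + 1), #{x ∈ T | p.1 ≠ p.2 ∧ x p.2 - x p.1 ∈ V} := Finset.card_biUnion_le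
    _ ≤ ∑ _p : Fin (m + 1) × Fin (m + 1), #S ^ m * #V := Finset.sum_le_sum fun p _ => hpair p
    _ = (m + 1) ^ 2 * (#S ^ m * #V) := by
        rw [Finset.sum_const, Finset.card_univ, Fintype.card_prod, Fintype.card_fin, smul_eq_mul]; ring

/-! ## §2 Boxes at scale `1/a` -/

/-- An integer of real absolute value `≤ t` lies in `[-⌊t⌋₊, ⌊t⌋₊]`. [folklore] -/
theorem abs_le_floor_of_abs_le {z : ℤ} {t : ℝ} (h : |((z : ℤ) : ℝ)| ≤ t) :
    -(⌊t⌋₊ : ℤ) ≤ z ∧ z ≤ ⌊t⌋₊ := by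
  have ht : 0 ≤ t := (abs_nonneg _).trans h
  have h1 : |z| ≤ (⌊t⌋₊ : ℤ) := by
    rw [Int.natCast_floor_eq_floor ht, Int.le_floor, Int.cast_abs]
    exact h
  exact abs_le.mp h1

/-- A site with `a·|z_l| ≤ t` for all `l` (`a > 0`) lies in `box 4 ⌊t/a⌋₊`. [folklore] -/
theorem mem_box_floor_of_forall_mul_abs_le {a t : ℝ} (ha : 0 < a) {z : Site 4}
    (hz : ∀ l : Fin 4, a * |((z l : ℤ) : ℝ)| ≤ t) : z ∈ box 4 ⌊t / a⌋₊ := by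
  rw [mem_box]
  intro l
  refine abs_le_floor_of_abs_le ?_
  rw [le_div_iff₀ ha, mul_comm]
  exact hz l

/-- A site with `a‖z‖ ≤ t` (`a > 0`, sup norm) lies in `box 4 ⌊t/a⌋₊`. [folklore] -/
theorem mem_box_floor_of_mul_norm_le {a t : ℝ} (ha : 0 < a) {z : Site 4} (hz : a * ‖z‖ ≤ t) :
    z ∈ box 4 ⌊t / a⌋₊ := by
  refine mem_box_floor_of_forall_mul_abs_le ha fun l => ?_
  have h1 : |((z l : ℤ) : ℝ)| ≤ ‖z‖ := by
    have h := norm_le_pi_norm z l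
    rwa [Int.norm_eq_abs] at h
  exact (mul_le_mul_of_nonneg_left h1 ha.le).trans hz

/-- `a⁴ · #box 4 ⌊t/a⌋₊ ≤ (2t + a)⁴` for `a > 0`, `t ≥ 0`. [folklore] -/
theorem pow_four_mul_card_box_floor_le {a t : ℝ} (ha : 0 < a) (ht : 0 ≤ t) :
    a ^ 4 * (#(box 4 ⌊t / a⌋₊) : ℝ) ≤ (2 * t + a) ^ 4 := by
  rw [card_box]
  push_cast
  have hN : (⌊t / a⌋₊ : ℝ) * a ≤ t := by
    rw [← le_div_iff₀ ha]; exact Nat.floor_le (div_nonneg ht ha.le)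
  have h1 : a ^ 4 * (2 * (⌊t / a⌋₊ : ℝ) + 1) ^ 4 = (2 * ((⌊t / a⌋₊ : ℝ) * a) + a) ^ 4 := by ring
  rw [h1]
  exact pow_le_pow_left₀ (by positivity) (by linarith) 4

/-! ## §3 The near-diagonal sum under a pointwise `O(a^{4n})` bound -/

/-- ★ **Near-diagonal count.**  Let `W, Φ` be weights on `n`-tuples of sites (`n ≥ 2`, `Φ ≥ 0`) with the dimension-4
pointwise bound `|W(x)|·Φ(x) ≤ B·a^{4n}` and `Φ(x) = 0` whenever some `a‖xᵢ‖ > K` (compact support at physical radius `K`).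
Then for `0 < a ≤ min 1 δ` the near-diagonal sum (tuples with a pair at physical sup-distance `< δ`) over `box(L)ⁿ` is
`≤ B · n² · (2K+1)^{4(n−1)} · (3δ)⁴`, uniformly in `L`. [folklore] -/
theorem near_sum_le {n : ℕ} (hn : 2 ≤ n) (W Φ : (Fin n → Site 4) → ℝ) (hΦ : ∀ x, 0 ≤ Φ x)
    {a δ K B : ℝ} (ha : 0 < a) (ha1 : a ≤ 1) (haδ : a ≤ δ) (hK : 0 ≤ K) (hB : 0 ≤ B)
    (hpt : ∀ x, |W x| * Φ x ≤ B * a ^ (4 * n))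
    (hsupp : ∀ x : Fin n → Site 4, (∃ i, K < a * ‖x i‖) → Φ x = 0) (L : ℕ) :
    ∑ x ∈ Fintype.piFinset (fun _ : Fin n => box 4 L),
        (if (∃ i j : Fin n, i ≠ j ∧ ∀ l : Fin 4, a * |((x i l - x j l : ℤ) : ℝ)| < δ) then |W x| * Φ x else 0)
      ≤ B * ((n : ℝ) ^ 2 * (2 * K + 1) ^ (4 * (n - 1)) * (3 * δ) ^ 4) := by
  classical
  obtain ⟨m, rfl⟩ : ∃ m, n = m + 1 := ⟨n - 1, by omega⟩
  have hδ : 0 < δ := lt_of_lt_of_le ha haδ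
  set S : Finset (Site 4) := box 4 ⌊K / a⌋₊ with hS
  set V : Finset (Site 4) := box 4 ⌊δ / a⌋₊ with hV
  set T := Fintype.piFinset (fun _ : Fin (m + 1) => box 4 L) with hT
  set c : ℝ := B * a ^ (4 * (m + 1)) with hc
  have hc0 : 0 ≤ c := by positivity
  set P : (Fin (m + 1) → Site 4) → Prop :=
    fun x => (∃ i j : Fin (m + 1), i ≠ j ∧ x j - x i ∈ V) ∧ ∀ i, x i ∈ S with hP
  -- pointwise comparison with the indicator of `P`
  have hpt' : ∀ x ∈ T,
      (if (∃ i j : Fin (m + 1), i ≠ j ∧ ∀ l : Fin 4, a * |((x i l - x j l : ℤ) : ℝ)| < δ)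
        then |W x| * Φ x else 0) ≤ (if P x then c else 0) := by
    intro x _
    by_cases h1 : ∃ i j : Fin (m + 1), i ≠ j ∧ ∀ l : Fin 4, a * |((x i l - x j l : ℤ) : ℝ)| < δ
    · rw [if_pos h1]
      by_cases h2 : P x
      · rw [if_pos h2]; exact hpt x
      · rw [if_neg h2]
        -- some `x i` lies outside `S`, hence `Φ x = 0`
        have hV' : ∃ i j : Fin (m + 1), i ≠ j ∧ x j - x i ∈ V := by
          obtain ⟨i, j, hij, hl⟩ := h1
          refine ⟨i, j, hij, mem_box_floor_of_forall_mul_abs_le ha fun l => ?_⟩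
          have e : (((x j - x i) l : ℤ) : ℝ) = -(((x i l - x j l : ℤ) : ℝ)) := by push_cast [Pi.sub_apply]; ring
          rw [e, abs_neg]; exact (hl l).le
        have hS' : ¬ ∀ i, x i ∈ S := fun h => h2 ⟨hV', h⟩
        obtain ⟨i, hi⟩ := not_forall.mp hS'
        have hKi : K < a * ‖x i‖ := by
          by_contra hle
          exact hi (mem_box_floor_of_mul_norm_le ha (not_lt.mp hle))
        rw [hsupp x ⟨i, hKi⟩, mul_zero]
    · rw [if_neg h1]
      split_ifs
      · exact hc0
      · exact le_rfl
  -- the count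
  have hcard : #{x ∈ T | P x} ≤ (m + 1) ^ 2 * (#S ^ m * #V) := by
    calc #{x ∈ T | P x} ≤ #{x ∈ Fintype.piFinset (fun _ : Fin (m + 1) => S) |
            ∃ i j : Fin (m + 1), i ≠ j ∧ x j - x i ∈ V} := by
          refine Finset.card_le_card fun x hx => ?_
          rw [Finset.mem_filter] at hx ⊢
          exact ⟨Fintype.mem_piFinset.mpr hx.2.2, hx.2.1⟩
      _ ≤ (m + 1) ^ 2 * (#S ^ m * #V) := card_filter_near_le S V m
  have hsum : ∑ x ∈ T, (if P x then c else 0) = (#{x ∈ T | P x} : ℝ) * c := by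
    rw [Finset.sum_ite, Finset.sum_const_zero, add_zero, Finset.sum_const, nsmul_eq_mul]
  -- the two box cardinalities at scale `1/a`
  have hSa : a ^ 4 * (#S : ℝ) ≤ (2 * K + 1) ^ 4 :=
    (pow_four_mul_card_box_floor_le ha hK).trans (pow_le_pow_left₀ (by positivity) (by linarith) 4)
  have hVa : a ^ 4 * (#V : ℝ) ≤ (3 * δ) ^ 4 :=
    (pow_four_mul_card_box_floor_le ha hδ.le).trans (pow_le_pow_left₀ (by positivity) (by linarith) 4)
  have hsplit : c * (((m + 1) ^ 2 * (#S ^ m * #V) : ℕ) : ℝ) =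
      B * (((m : ℝ) + 1) ^ 2 * ((a ^ 4 * (#S : ℝ)) ^ m * (a ^ 4 * (#V : ℝ)))) := by
    push_cast
    rw [hc, pow_mul, pow_succ]; ring
  calc ∑ x ∈ T, (if (∃ i j : Fin (m + 1), i ≠ j ∧ ∀ l : Fin 4, a * |((x i l - x j l : ℤ) : ℝ)| < δ)
          then |W x| * Φ x else 0)
      ≤ ∑ x ∈ T, (if P x then c else 0) := Finset.sum_le_sum hpt'
    _ = (#{x ∈ T | P x} : ℝ) * c := hsum
    _ ≤ (((m + 1) ^ 2 * (#S ^ m * #V) : ℕ) : ℝ) * c := by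
        exact mul_le_mul_of_nonneg_right (by exact_mod_cast hcard) hc0
    _ = B * (((m : ℝ) + 1) ^ 2 * ((a ^ 4 * (#S : ℝ)) ^ m * (a ^ 4 * (#V : ℝ)))) := by rw [mul_comm, hsplit]
    _ ≤ B * ((((m + 1 : ℕ) : ℝ)) ^ 2 * (2 * K + 1) ^ (4 * (m + 1 - 1)) * (3 * δ) ^ 4) := by
        have hm : (((m + 1 : ℕ) : ℝ)) = (m : ℝ) + 1 := by push_cast; ring
        rw [hm, Nat.add_sub_cancel, pow_mul]
        have h1 : (a ^ 4 * (#S : ℝ)) ^ m ≤ ((2 * K + 1) ^ 4) ^ m :=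
          pow_le_pow_left₀ (by positivity) hSa m
        have h2 : (a ^ 4 * (#S : ℝ)) ^ m * (a ^ 4 * (#V : ℝ)) ≤ ((2 * K + 1) ^ 4) ^ m * (3 * δ) ^ 4 :=
          mul_le_mul h1 hVa (by positivity) (by positivity)
        have h3 : ((m : ℝ) + 1) ^ 2 * ((a ^ 4 * (#S : ℝ)) ^ m * (a ^ 4 * (#V : ℝ))) ≤
            ((m : ℝ) + 1) ^ 2 * (((2 * K + 1) ^ 4) ^ m * (3 * δ) ^ 4) :=
          mul_le_mul_of_nonneg_left h2 (by positivity)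
        calc B * (((m : ℝ) + 1) ^ 2 * ((a ^ 4 * (#S : ℝ)) ^ m * (a ^ 4 * (#V : ℝ))))
            ≤ B * (((m : ℝ) + 1) ^ 2 * (((2 * K + 1) ^ 4) ^ m * (3 * δ) ^ 4)) := mul_le_mul_of_nonneg_left h3 hB
          _ = B * (((m : ℝ) + 1) ^ 2 * ((2 * K + 1) ^ 4) ^ m * (3 * δ) ^ 4) := by ring

/-- The near-diagonal indicator sums are monotone in the nearness scale `δ`. [folklore] -/
theorem ite_near_mono {n : ℕ} {a δ δ' : ℝ} (hδ : δ ≤ δ') (x : Fin n → Site 4) {t : ℝ} (ht : 0 ≤ t) :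
    (if (∃ i j : Fin n, i ≠ j ∧ ∀ l : Fin 4, a * |((x i l - x j l : ℤ) : ℝ)| < δ) then t else 0) ≤
      (if (∃ i j : Fin n, i ≠ j ∧ ∀ l : Fin 4, a * |((x i l - x j l : ℤ) : ℝ)| < δ') then t else 0) := by
  by_cases h1 : ∃ i j : Fin n, i ≠ j ∧ ∀ l : Fin 4, a * |((x i l - x j l : ℤ) : ℝ)| < δ
  · have h2 : ∃ i j : Fin n, i ≠ j ∧ ∀ l : Fin 4, a * |((x i l - x j l : ℤ) : ℝ)| < δ' := by
      obtain ⟨i, j, hij, hl⟩ := h1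
      exact ⟨i, j, hij, fun l => (hl l).trans_le hδ⟩
    rw [if_pos h1, if_pos h2]
  · rw [if_neg h1]
    split_ifs
    · exact ht
    · exact le_rfl

end Summit.QuantumFields.YangMills.Theorems.RecentredCoverTransfer.NearDiagonal
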